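import Summits.Parity.GeneralizedHardyLittlewood.Theses.LiouvilleShiftedTables

/-!
# Line `corner-local-box` — crux `TableChowla` (stmt-Parity-14270, rank 2 of route
`LiouvilleShiftedTables`), crux-plan round 1

Crux (`Summit.Parity.GeneralizedHardyLittlewood.Theses.LiouvilleShiftedTables.TableChowla`, verbatim):
for every shift `c ≠ 0`, every `0 < δ ≤ 1/12`, every `C > 0` and all large `x`, uniformly for
`x^δ ≤ A ≤ x^{1/3+δ}`,
`T := Σ_{a,a' ∈ (⌊A⌋,⌊2A⌋]} (Σ_{b ≤ ⌊x/A⌋} λ(ab+c) λ(a'b+c))² ≤ x² / (log x)^C`.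

## The line (card `Ideas/corner-local-box.md`, REPAIRED as the triage panel and `Disproof.lean` (g) demand)

`T` is the box norm of the table `Φ(a,b) = λ(ab+c)`.  Two finite van der Corput differencings — across
the rows (gap `h`, width `H`) and across the columns (gap `k`, width `K`) — localise it EXACTLY:

  `H·K·T ≤ (N+H−1)(B+K−1) · [ N·B·K + 2·N·B·H + 4·Σ_{1≤h<H} Σ_{1≤k<K} |𝒞(h,k)| ]`      (STUB 1)

(`N = ⌊2A⌋−⌊A⌋` rows, `B = ⌊x/A⌋` columns), where the first two terms are the two AXES `a = a'` and
`b = b'` of the local box (sums of squares — this is exactly where the card's `C⁺ = LocalBoxChowla`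
was FALSE as filed, `Disproof.IdeaR1.not_localBoxChowla_r1`; in the repaired line they are diagonal
terms costing `x²/H + 2x²/K`, never targets), and `𝒞(h,k)` is the OFF-AXIS IN-BOX CORNER SUM

  `𝒞(h,k) = Σ_{a, a+h ∈ rows} Σ_{b, b+k ∈ cols} λ(ab+c) λ((a+h)b+c) λ(a(b+k)+c) λ((a+h)(b+k)+c)`.

With `H = K = ⌊(log x)^{C+1}⌋` the crux follows from the log-power corner bound

  `|𝒞(h,k)| ≤ x/(log x)^K'` for all `1 ≤ h, k ≤ (log x)^{K'}`, eventually, uniformly in the window  (STUB 2)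

at `K' = C + 1` (the composition `TableChowla_of` below does this bookkeeping for real:
`T ≤ 6x·10x·H/H² ≤ 120 x²/(log x)^{C+1} ≤ x²/(log x)^C` once `log x ≥ 120`).

Every 2×2 block of the shifted table has determinant `h k c`:
`(ab+c)((a+h)(b+k)+c) − ((a+h)b+c)(a(b+k)+c) = hkc` (`block_det`, `ring`), so by complete
multiplicativity each corner summand is `λ(Q)·λ(Q + hkc)`, `Q = ((a+h)b+c)(a(b+k)+c)`
(`cornerSum_eq_detPairSum`, PROVED below for `c ≥ −⌊A⌋`): STUB 2 is binary Chowla at the FIXED tiny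
shift `hkc` sampled along the two-parameter determinant family — and at `c = 0` the two factors
coincide, every summand is `λ(Q)² = 1` and `𝒞 ≡ #box`: the identity is the exact place where the
load-bearing hypothesis `c ≠ 0` (`Disproof.not_tableChowlaWithoutShiftNeZero`) enters the line.

## Registered stubs (the ONLY `sorry`s of this file)

* `stub_doubleVdC` — STUB 1, the exact finite double van der Corput localisation, for EVERY
  1-bounded `f : ℕ → ℝ`, every `c`, all row/column ranges and all widths `H, K ≥ 1`.  Size M,
  PROVABLE NOW: the row step `H·T ≤ (N+H−1)·T_band(H)` is `Disproof.vdC_momentN` verbatim (copy it);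
  the column step is `Disproof.vdC_pointwise` applied to `u(b) = f(ab+c)f(a'b+c)` for each band pair,
  followed by the three-way split {`a = a'`} ∪ {`a ≠ a'`, `b = b'`} ∪ {off-axis} and the symmetrisation
  `(a,a') ↔ (a',a)`, `(b,b') ↔ (b',b)` of the off-axis part (`= 4·Σ_{h,k ≥ 1} (K−k)·𝒞(h,k)`);
  the overlap weights are `≤ K`, `Σ_{b'} w(b,b') ≤ K²`.  Checked numerically on 10 020 small tables
  (random ±1, rank one, λ-tables, structured) with relative slack ≥ 1/2 (planner folder
  `scratch/vdc_test.py`; kit job j008041 repeats it on λ-tables with `B ≤ 3000`).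
* `stub_corner` — STUB 2, the off-axis corner bound (`= Disproof.IdeaR1.LocalBoxChowlaOffAxes` up to
  the in-box truncation `a+h ≤ ⌊2A⌋`, `b+k ≤ ⌊x/A⌋` and `1 ≤ h,k` in place of `h,k ≠ 0`).  OPEN and
  load-bearing (hardest): a `(log x)^{-K}`, `∀K`, saving in a 4-point correlation of `λ` at the four
  pairwise non-proportional bilinear forms of a 2×2 block, individually for each of the `(log x)^{2K}`
  gaps; random model `|𝒞| ≍ √x`.  Strictly stronger than the crux (it implies it by STUB 1; the crux
  controls corners only on average), weaker than nothing known.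

`tableChowla_of_stubs` composes the two stubs into the crux BY NAME (kernel-checked; no `sorry` outside the
two `stub_*`; hypotheses are the name-keyed aliases `Registered.stub_*`), and `TableChowla_of : TableChowla`
is the closed statement fed by the two registered stubs (second lead's re-wiring, 2026-08-16).

## Disproof used (`Cruxes/TableChowla/Disproof.lean`, cdisprove gen-2 v10, 2791 lines, read 2026-08-16)

* (a) `not_tableChowlaWithoutShiftNeZero` — HONOURED at `stub_corner`: at `c = 0` every corner summand
  is `λ(ab)²λ((a+h)(b+k))²·… = λ(a)²λ(b)²λ(a+h)²λ(b+k)² = 1`, `𝒞 = #box ≍ x`, so STUB 2 is false at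
  `c = 0` and any proof of it must use `c ≠ 0`; `block_det`/`cornerSum_eq_detPairSum` name the spot.
  `not_tableChowlaWithoutDeltaLe` (= negatives stmt-Parity-4218), `…WithoutLowerWindow/UpperWindow/
  DeltaPos` — HONOURED: STUB 2 keeps `0 < δ ≤ 1/12` and the window verbatim; STUB 1 is unconditional.
* (c) `not_tableChowlaUniformPowerSaving`, `not_tableChowlaThresholdUniformInC`,
  `not_tableChowlaPolylogWindow` — respected: log-power targets only, `∀ K ∃ x₀` order, window `≥ x^δ`.
* (c′)(c″) pretenders `not_tableChowlaFor_one/chi4/unitChar/principal` — consistent: for `f ≡ 1` every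
  corner is `#box`; for `χ₄` at `c = 4` the corner summand is `χ₄(a)²χ₄(a+h)²χ₄(b)²χ₄(b+k)² ≥ 0`
  (rank one), so STUB 2 fails for the pretenders exactly as the crux does — its proof must use the
  non-pretentiousness of `λ` (to real characters of conductor dividing `c`, uniformly in `|t| ≤ x`).
* (d) `tableChowla_of_uniformBinaryChowla` — the line sits ABOVE this resistance line in strength
  (STUB 2 is 4-point), noted honestly in the card; (h) `tableChowla_iff_fewBadPairs` — not engaged.
* (g) `IdeaR1.not_localBoxChowla_r1` — ANSWERED: the axes are STUB 1's first two terms, STUB 2 is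
  off-axis only (`1 ≤ h`, `1 ≤ k`).  (j) `vdC_momentN`, `tableChowla_of_bandBound` and (l)
  `vdC_momentN_cols` — the two one-variable halves of STUB 1, both PROVED there; STUB 1 is their
  composition with the corner split, and `TableChowla_of` follows `tableChowla_of_bandBound`.
* Landed `Theorems/TableChowla/Negative/`: none besides the re-exported 4218 (checked `ledger negatives
  --problem Parity` 2026-08-16: 4218, 9541, 14832) — no stub is an instance of any of them.
-/

noncomputable section

open Finset Real ArithmeticFunction

namespace Summit.Parity.GeneralizedHardyLittlewood.Cruxes.TableChowla.CornerLocalBox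

/-! ## Objects (local abbreviations; the registered stubs below inline them verbatim) -/

/-- Liouville's function cast to `ℝ` (`λ 0 = 0`, the `Int.toNat` junk value, absent in the window). -/
def lam (n : ℕ) : ℝ := (ArithmeticFunction.liouville n : ℝ)

/-- Row correlation `S_f(a,a') = Σ_{b ≤ B} f(ab+c) f(a'b+c)` (verbatim the crux's inner sum). -/
def rowCorr (f : ℕ → ℝ) (c : ℤ) (B a a' : ℕ) : ℝ :=
  ∑ b ∈ Icc 1 B, f (Int.toNat ((a : ℤ) * b + c)) * f (Int.toNat ((a' : ℤ) * b + c))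

/-- Fourth moment `T = tr (M Mᵀ)²` of the table with rows `Ioc A₁ A₂` and columns `Icc 1 B`. -/
def momentN (f : ℕ → ℝ) (c : ℤ) (A₁ A₂ B : ℕ) : ℝ :=
  ∑ a ∈ Ioc A₁ A₂, ∑ a' ∈ Ioc A₁ A₂, rowCorr f c B a a' ^ 2

/-- The OFF-AXIS IN-BOX CORNER SUM `𝒞_f(h,k)`: rows `a, a+h ∈ Ioc A₁ A₂`, columns `b, b+k ∈ Icc 1 B`. -/
def cornerSum (f : ℕ → ℝ) (c : ℤ) (h k A₁ A₂ B : ℕ) : ℝ :=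
  ∑ a ∈ Ioc A₁ (A₂ - h), ∑ b ∈ Icc 1 (B - k),
    f (Int.toNat ((a : ℤ) * b + c)) * f (Int.toNat (((a : ℤ) + h) * b + c)) *
      f (Int.toNat ((a : ℤ) * ((b : ℤ) + k) + c)) * f (Int.toNat (((a : ℤ) + h) * ((b : ℤ) + k) + c))

/-- The crux with `λ` replaced by an arbitrary `f`. -/
def TableChowlaFor (f : ℕ → ℝ) : Prop :=
  ∀ c : ℤ, c ≠ 0 → ∀ δ : ℝ, 0 < δ → δ ≤ 1 / 12 → ∀ C : ℝ, 0 < C → ∃ x₀ : ℝ, ∀ x : ℝ, x₀ ≤ x →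
    ∀ A : ℝ, x ^ δ ≤ A → A ≤ x ^ (1 / 3 + δ) →
      momentN f c ⌊A⌋₊ ⌊2 * A⌋₊ ⌊x / A⌋₊ ≤ x ^ 2 / Real.log x ^ C

/-- READ-BACK: the crux is literally `TableChowlaFor λ`. -/
theorem tableChowla_iff :
    Summit.Parity.GeneralizedHardyLittlewood.Theses.LiouvilleShiftedTables.TableChowla ↔
      TableChowlaFor lam := Iff.rfl

/-! ## The two statements of the line -/

/-- STUB 1 statement — EXACT DOUBLE VAN DER CORPUT LOCALISATION of the fourth moment to the two axes
plus the off-axis in-box corner sums, for every 1-bounded `f`, every shift, every row/column range and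
all widths `H, K ≥ 1`. -/
def DoubleVdC : Prop :=
  ∀ f : ℕ → ℝ, (∀ n, |f n| ≤ 1) → ∀ (c : ℤ) (A₁ A₂ B H K : ℕ), 1 ≤ H → 1 ≤ K →
    (H : ℝ) * K * momentN f c A₁ A₂ B ≤
      (((A₂ - A₁ : ℕ) : ℝ) + H - 1) * ((B : ℝ) + K - 1) *
        (((A₂ - A₁ : ℕ) : ℝ) * B * K + 2 * ((A₂ - A₁ : ℕ) : ℝ) * B * H +
          4 * ∑ h ∈ Icc 1 (H - 1), ∑ k ∈ Icc 1 (K - 1), |cornerSum f c h k A₁ A₂ B|)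

/-- STUB 2 statement — OFF-AXIS CORNER CHOWLA (the repaired `C⁺` of the card): log-power cancellation in
every off-axis in-box corner sum with gaps `1 ≤ h, k ≤ (log x)^K`, eventually, uniformly in the window. -/
def CornerChowla : Prop :=
  ∀ c : ℤ, c ≠ 0 → ∀ δ : ℝ, 0 < δ → δ ≤ 1 / 12 → ∀ K : ℝ, 0 < K → ∃ x₀ : ℝ, ∀ x : ℝ, x₀ ≤ x →
    ∀ A : ℝ, x ^ δ ≤ A → A ≤ x ^ (1 / 3 + δ) → ∀ h k : ℕ, 1 ≤ h → (h : ℝ) ≤ Real.log x ^ K →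
      1 ≤ k → (k : ℝ) ≤ Real.log x ^ K →
        |cornerSum lam c h k ⌊A⌋₊ ⌊2 * A⌋₊ ⌊x / A⌋₊| ≤ x / Real.log x ^ K

/-- AVERAGED OFF-AXIS CORNER BOUND — the WEAKER statement the composition actually consumes (second
lead, 2026-08-16): with `H := ⌊(log x)^K⌋`, the lag-SUM `Σ_{1≤h,k≤H−1} |𝒞_λ(h,k)| ≤ H²·x/(log x)^K`, eventually,
uniformly in the window.  `CornerChowla → AvgCornerChowla` (`avgCornerChowla_of_cornerChowla`) and
`stub_doubleVdC → AvgCornerChowla → TableChowla` (`tableChowla_of_avg`); so a refutation of the pointwise stub at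
a single biased lag would call for reshaping `stub_corner` to this average, not for abandoning the composition. -/
def AvgCornerChowla : Prop :=
  ∀ c : ℤ, c ≠ 0 → ∀ δ : ℝ, 0 < δ → δ ≤ 1 / 12 → ∀ K : ℝ, 0 < K → ∃ x₀ : ℝ, ∀ x : ℝ, x₀ ≤ x →
    ∀ A : ℝ, x ^ δ ≤ A → A ≤ x ^ (1 / 3 + δ) →
      ∑ h ∈ Icc 1 (⌊Real.log x ^ K⌋₊ - 1), ∑ k ∈ Icc 1 (⌊Real.log x ^ K⌋₊ - 1),
        |cornerSum lam c h k ⌊A⌋₊ ⌊2 * A⌋₊ ⌊x / A⌋₊| ≤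
          (⌊Real.log x ^ K⌋₊ : ℝ) ^ 2 * (x / Real.log x ^ K)

/-! ## The registered stubs (`sorry` lives only here; signatures inlined over Mathlib so that a
Theorems-side `propose --supports stmt-Parity-14270` proof can restate them textually) -/

/-- **STUB 1 · `stub_doubleVdC`** (M, PROVABLE NOW — pure finite combinatorics, no number theory).
`H·K·T ≤ (N+H−1)(B+K−1)·[N·B·K + 2·N·B·H + 4·Σ_{1≤h<H}Σ_{1≤k<K} |𝒞_f(h,k)|]`, `N = A₂ − A₁`.
Proof plan: (i) rows — `H·T ≤ (A₂+H−1−A₁)·T_band(H)` with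
`T_band(H) = Σ_{a∈rows} Σ_{a'∈rows, a'<a+H, a<a'+H} S(a,a')²` (`Disproof.vdC_momentN`, 75 lines, copy);
(ii) columns — for each band pair, `K²·S(a,a')² ≤ (B+K−1)·Σ_{b,b'} w(b,b')·f(ab+c)f(a'b+c)f(ab'+c)f(a'b'+c)`
with `w(b,b') = #{m ∈ [1,B+K−1] : m ∈ [b,b+K) ∩ [b',b'+K)}` (`Disproof.vdC_pointwise` with
`I = Icc 1 B`, `M = Icc 1 (B+K−1)`); (iii) split: `a = a'` gives `≤ N·Σ_{b,b'} w ≤ N·B·K²`;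
`a ≠ a'`, `b = b'` gives `≤ N(2H−2)·B·K`; the rest is symmetric under `a ↔ a'` and `b ↔ b'`, equal to
`4·Σ_{h=1}^{H−1}Σ_{k=1}^{K−1} (K−k)·𝒞_f(h,k)` (`a' = a+h`, `b' = b+k`, `w(b,b+k) = K−k`), bounded by
`4K·ΣΣ|𝒞|`; divide by `K`.  Edge cases (`A₂ ≤ A₁`, `B = 0`, `H > N`, `K > B`) hold as stated
(natural subtraction; empty sums).  Leans on: `Finset.sum_mul_sq_le_sq_mul_sq`, `Finset.sum_comm`,
`Finset.sum_image`, `Nat.card_Icc/Ioc`. -/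
theorem stub_doubleVdC : ∀ f : ℕ → ℝ, (∀ n, |f n| ≤ 1) → ∀ (c : ℤ) (A₁ A₂ B H K : ℕ), 1 ≤ H → 1 ≤ K →
    (H : ℝ) * K * (∑ a ∈ Finset.Ioc A₁ A₂, ∑ a' ∈ Finset.Ioc A₁ A₂,
      (∑ b ∈ Finset.Icc 1 B, f (Int.toNat ((a : ℤ) * b + c)) * f (Int.toNat ((a' : ℤ) * b + c))) ^ 2) ≤
      (((A₂ - A₁ : ℕ) : ℝ) + H - 1) * ((B : ℝ) + K - 1) *
        (((A₂ - A₁ : ℕ) : ℝ) * B * K + 2 * ((A₂ - A₁ : ℕ) : ℝ) * B * H +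
          4 * ∑ h ∈ Finset.Icc 1 (H - 1), ∑ k ∈ Finset.Icc 1 (K - 1),
            |∑ a ∈ Finset.Ioc A₁ (A₂ - h), ∑ b ∈ Finset.Icc 1 (B - k),
              f (Int.toNat ((a : ℤ) * b + c)) * f (Int.toNat (((a : ℤ) + h) * b + c)) *
                f (Int.toNat ((a : ℤ) * ((b : ℤ) + k) + c)) *
                  f (Int.toNat (((a : ℤ) + h) * ((b : ℤ) + k) + c))|) := by
  sorry

/-- **STUB 2 · `stub_corner`** (OPEN — the load-bearing, hardest stub; beyond all published technology).
For every `c ≠ 0`, `0 < δ ≤ 1/12`, `K > 0`, eventually in `x`, uniformly for `x^δ ≤ A ≤ x^{1/3+δ}` and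
all gaps `1 ≤ h, k ≤ (log x)^K`:
`|Σ_{a, a+h ∈ (⌊A⌋,⌊2A⌋]} Σ_{b, b+k ∈ [1,⌊x/A⌋]} λ(ab+c)λ((a+h)b+c)λ(a(b+k)+c)λ((a+h)(b+k)+c)| ≤ x/(log x)^K`.
Trivial bound `#box ≤ 2x`; random model `≍ √x`; at `c = 0` it is FALSE (`= #box`), for the pretenders
`1`, `χ₄` (shift `4`) it is false — non-pretentiousness of `λ` and `c ≠ 0` are both used by any proof.
Equivalent readings (all by regrouping the four factors with `λ(m)λ(n) = λ(mn)`):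
(α) `Σ_{a,b} λ(Q)λ(Q + hkc)`, `Q = ((a+h)b+c)(a(b+k)+c)` — binary Chowla at the fixed shift `hkc`
along the determinant family (`cornerSum_eq_detPairSum` below);
(β) `Σ_a Σ_b α_a(b)α_a(b+k)`, `α_a(b) = λ(ab+c)λ((a+h)b+c)` — the lag-`k` autocorrelation of the
band-pair sequence of the sibling line `slope-band-vdc`, summed over `a` (so STUB 2 says: the band-pair
sequences are white at lags `< (log x)^K` on average over `a`, which by one vdC gives that line's
`BandChowla` per `h`);
(γ) `Σ_b Σ_a v_b(a)v_b(a+h)`, `v_b(a) = λ(ba+c)λ((b+k)a+c)` — short (`a ∼ A ≥ x^δ`) lag-`h`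
autocorrelations of column-pair products averaged over `b ≤ x/A` (the Matomäki–Radziwiłł shape).
Why it might fail: a 4-point correlation with `(log x)^{-K}` ∀K saving, individually per gap — above
`UniformBinaryChowla` (Disproof (d)) in strength; only log-averaged `o(1)` results exist even for 2-point
fixed-shift Chowla (Tao 2016, Tao–Teräväinen 2019, Helfgott–Radziwiłł 2021, Pilatte 2023) and none along
a density-`1/x` polynomial family.  Sources: MatomakiRadziwillTao2015, arXiv:1509.05422,
TaoTeravainen2019 (Duke), arXiv:2109.06291, DukeFriedlanderIwaniec1997Determinant,
Literature.Barriers.Parity.Polymath2014_liouvillePairAP, Literature.Barriers.Parity.TrueComplexityBinary. -/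
theorem stub_corner : ∀ c : ℤ, c ≠ 0 → ∀ δ : ℝ, 0 < δ → δ ≤ 1 / 12 → ∀ K : ℝ, 0 < K → ∃ x₀ : ℝ,
    ∀ x : ℝ, x₀ ≤ x → ∀ A : ℝ, x ^ δ ≤ A → A ≤ x ^ (1 / 3 + δ) → ∀ h k : ℕ, 1 ≤ h →
      (h : ℝ) ≤ Real.log x ^ K → 1 ≤ k → (k : ℝ) ≤ Real.log x ^ K →
        |∑ a ∈ Finset.Ioc ⌊A⌋₊ (⌊2 * A⌋₊ - h), ∑ b ∈ Finset.Icc 1 (⌊x / A⌋₊ - k),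
          (ArithmeticFunction.liouville (Int.toNat ((a : ℤ) * b + c)) : ℝ) *
            (ArithmeticFunction.liouville (Int.toNat (((a : ℤ) + h) * b + c)) : ℝ) *
            (ArithmeticFunction.liouville (Int.toNat ((a : ℤ) * ((b : ℤ) + k) + c)) : ℝ) *
            (ArithmeticFunction.liouville (Int.toNat (((a : ℤ) + h) * ((b : ℤ) + k) + c)) : ℝ)| ≤
          x / Real.log x ^ K := by
  sorry

/-! ## Consistency: each named statement IS its registered stub (definitionally) -/

theorem doubleVdC_holds : DoubleVdC := stub_doubleVdC
theorem cornerChowla_holds : CornerChowla := stub_corner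

/-! ## Name-keyed aliases of the two statements (the hypotheses of the composition) -/
namespace Registered

/-- Alias of `DoubleVdC` keyed by the registered stub name. -/
abbrev stub_doubleVdC : Prop := DoubleVdC
/-- Alias of `CornerChowla` keyed by the registered stub name. -/
abbrev stub_corner : Prop := CornerChowla

end Registered

/-! ## Proved glue: facts about `λ`, eventualities, nonnegativity -/

/-- Junk value `λ 0 = 0`. -/
theorem lam_zero : lam 0 = 0 := by simp [lam]

/-- `λ(n)² = 1` for `n ≥ 1`. -/
theorem lam_sq {n : ℕ} (hn : n ≠ 0) : lam n ^ 2 = 1 := by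
  unfold lam
  rw [liouville_apply hn]
  push_cast
  rw [← pow_mul, mul_comm, pow_mul]
  norm_num

/-- Complete multiplicativity of `λ` (over `ℝ`). -/
theorem lam_mul (m n : ℕ) : lam (m * n) = lam m * lam n := by
  unfold lam
  rw [liouville_apply_mul]
  push_cast
  ring

/-- `λ(n)² ≤ 1` for all `n` (junk value included). -/
theorem lam_sq_le_one (n : ℕ) : lam n ^ 2 ≤ 1 := by
  rcases eq_or_ne n 0 with rfl | hn
  · simp [lam_zero]
  · rw [lam_sq hn]

/-- `|λ(n)| ≤ 1`: `λ` is an admissible `f` for STUB 1. -/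
theorem abs_lam_le_one : ∀ n : ℕ, |lam n| ≤ 1 := by
  intro n
  have h := lam_sq_le_one n
  rw [abs_le]
  constructor <;> nlinarith [sq_nonneg (lam n - 1), sq_nonneg (lam n + 1)]

/-- The fourth moment is a sum of squares. -/
theorem momentN_nonneg (f : ℕ → ℝ) (c : ℤ) (A₁ A₂ B : ℕ) : 0 ≤ momentN f c A₁ A₂ B :=
  sum_nonneg fun _ _ => sum_nonneg fun _ _ => sq_nonneg _

/-- EVENTUALITY: beyond some `X(δ, C)`, `(log x)^{C+1} ≤ x^δ` and `240 ≤ log x`. -/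
theorem eventually_log_rpow_le_rpow {δ : ℝ} (hδ : 0 < δ) (C : ℝ) :
    ∃ X : ℝ, ∀ x : ℝ, X ≤ x → Real.log x ^ (C + 1) ≤ x ^ δ ∧ 240 ≤ Real.log x := by
  have hev : ∀ᶠ x in Filter.atTop, ‖Real.log x ^ (C + 1)‖ ≤ 1 * ‖x ^ δ‖ :=
    (isLittleO_log_rpow_rpow_atTop (C + 1) hδ).bound one_pos
  obtain ⟨X, hX⟩ := Filter.eventually_atTop.mp hev
  refine ⟨max X (Real.exp 240), fun x hx => ?_⟩
  have hxX : X ≤ x := le_trans (le_max_left _ _) hx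
  have hxe : Real.exp 240 ≤ x := le_trans (le_max_right _ _) hx
  have hxpos : 0 < x := (Real.exp_pos 240).trans_le hxe
  have hlog : 240 ≤ Real.log x := (Real.le_log_iff_exp_le hxpos).mpr hxe
  have := hX x hxX
  rw [Real.norm_eq_abs, Real.norm_eq_abs, abs_of_nonneg (Real.rpow_nonneg (by linarith) _),
    abs_of_nonneg (Real.rpow_nonneg hxpos.le δ), one_mul] at this
  exact ⟨this, hlog⟩

/-! ## The composition: the two stubs imply the crux, by name -/

/-- **`TableChowla` from `stub_doubleVdC` and the AVERAGED corner bound** (real proof, no `sorry`): take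
the averaged corner bound at exponent `C + 1`, put `H = K = ⌊(log x)^{C+1}⌋` in the double van der Corput
inequality and do the window bookkeeping (`N ≤ 2A`, `B ≤ x/A`, `H ≤ (log x)^{C+1} ≤ x^δ ≤ A`, `A² ≤ x`):
`H²T ≤ 6x · 10xH`, so `T ≤ 120x²/(log x)^{C+1} ≤ x²/(log x)^C` once `log x ≥ 120`. -/
theorem tableChowla_of_avg (hV : Registered.stub_doubleVdC) (hC : AvgCornerChowla) :
    Summit.Parity.GeneralizedHardyLittlewood.Theses.LiouvilleShiftedTables.TableChowla := by
  rw [tableChowla_iff]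
  intro c hc δ hδ hδ' C hC0
  -- the averaged corner bound at exponent `C + 1`
  obtain ⟨x₀, hx₀⟩ := hC c hc δ hδ hδ' (C + 1) (by linarith)
  -- eventually `(log x)^(C+1) ≤ x^δ` and `240 ≤ log x`
  obtain ⟨X₁, hX₁⟩ := eventually_log_rpow_le_rpow hδ C
  refine ⟨max x₀ (max X₁ 1), fun x hx A hA hA' => ?_⟩
  have hx₀x : x₀ ≤ x := le_trans (le_max_left _ _) hx
  have hxX₁ : X₁ ≤ x := le_trans (le_trans (le_max_left _ _) (le_max_right _ _)) hx
  have hx1 : 1 ≤ x := le_trans (le_trans (le_max_right _ _) (le_max_right _ _)) hx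
  have hxpos : 0 < x := by linarith
  obtain ⟨hLA', hlog⟩ := hX₁ x hxX₁
  have hlogpos : 0 < Real.log x := by linarith
  have hlog1 : 1 ≤ Real.log x := by linarith
  -- the window
  have hAone : 1 ≤ A := le_trans (Real.one_le_rpow hx1 hδ.le) hA
  have hApos : 0 < A := by linarith
  have hA2x : A ^ 2 ≤ x := by
    have h1 : A ≤ x ^ (1 / 2 : ℝ) :=
      hA'.trans (Real.rpow_le_rpow_of_exponent_le hx1 (by linarith))
    have h2 : (x ^ (1 / 2 : ℝ)) ^ 2 = x := by
      rw [← Real.sqrt_eq_rpow, Real.sq_sqrt hxpos.le]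
    calc A ^ 2 ≤ (x ^ (1 / 2 : ℝ)) ^ 2 := pow_le_pow_left₀ hApos.le h1 2
      _ = x := h2
  -- `L = (log x)^(C+1)` and `H = ⌊L⌋`
  set L : ℝ := Real.log x ^ (C + 1) with hL
  have hLge : Real.log x ≤ L := by
    calc Real.log x = Real.log x ^ (1 : ℝ) := (Real.rpow_one _).symm
      _ ≤ L := Real.rpow_le_rpow_of_exponent_le hlog1 (by linarith)
  have hL240 : 240 ≤ L := hlog.trans hLge
  have hLpos : 0 < L := by linarith
  have hLA : L ≤ A := hLA'.trans hA
  set H : ℕ := ⌊L⌋₊ with hHdef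
  have hHleL : (H : ℝ) ≤ L := Nat.floor_le hLpos.le
  have hHge : L - 1 ≤ H := by
    have := Nat.lt_floor_add_one L
    rw [hHdef]
    linarith
  have hH1 : 1 ≤ H := by
    rw [hHdef, Nat.one_le_floor_iff]
    linarith
  have hH1r : (1 : ℝ) ≤ H := by exact_mod_cast hH1
  have hHpos : (0 : ℝ) < H := by linarith
  have hHleA : (H : ℝ) ≤ A := hHleL.trans hLA
  -- floors of the window
  have hNle : ((⌊2 * A⌋₊ - ⌊A⌋₊ : ℕ) : ℝ) ≤ 2 * A := by
    rw [Nat.cast_sub (Nat.floor_le_floor (by linarith : A ≤ 2 * A))]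
    have h1 : (⌊2 * A⌋₊ : ℝ) ≤ 2 * A := Nat.floor_le (by linarith)
    have h2 : A - 1 < (⌊A⌋₊ : ℝ) := by have := Nat.lt_floor_add_one A; linarith
    linarith
  have hN0 : (0 : ℝ) ≤ ((⌊2 * A⌋₊ - ⌊A⌋₊ : ℕ) : ℝ) := Nat.cast_nonneg _
  have hBle : (⌊x / A⌋₊ : ℝ) ≤ x / A := Nat.floor_le (by positivity)
  have hB0 : (0 : ℝ) ≤ (⌊x / A⌋₊ : ℝ) := Nat.cast_nonneg _
  have hNB : ((⌊2 * A⌋₊ - ⌊A⌋₊ : ℕ) : ℝ) * (⌊x / A⌋₊ : ℝ) ≤ 2 * x := by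
    calc ((⌊2 * A⌋₊ - ⌊A⌋₊ : ℕ) : ℝ) * (⌊x / A⌋₊ : ℝ) ≤ (2 * A) * (x / A) :=
          mul_le_mul hNle hBle hB0 (by positivity)
      _ = 2 * x := by field_simp
  -- STUB 1 at `(λ, c, rows, columns, H, H)`
  have hv := hV lam abs_lam_le_one c ⌊A⌋₊ ⌊2 * A⌋₊ ⌊x / A⌋₊ H H hH1 hH1
  -- the AVERAGED corner bound on the local box: `ΣΣ|𝒞| ≤ H²·x/L ≤ H·x`
  have hsum : ∑ h ∈ Icc 1 (H - 1), ∑ k ∈ Icc 1 (H - 1),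
      |cornerSum lam c h k ⌊A⌋₊ ⌊2 * A⌋₊ ⌊x / A⌋₊| ≤ (H : ℝ) * x := by
    have h2 : 0 ≤ x / L := by positivity
    have h4 : (H : ℝ) * (x / L) ≤ x := by
      calc (H : ℝ) * (x / L) ≤ L * (x / L) := mul_le_mul_of_nonneg_right hHleL h2
        _ = x := by field_simp
    have havg := hx₀ x hx₀x A hA hA'
    rw [← hL, ← hHdef] at havg
    calc ∑ h ∈ Icc 1 (H - 1), ∑ k ∈ Icc 1 (H - 1), |cornerSum lam c h k ⌊A⌋₊ ⌊2 * A⌋₊ ⌊x / A⌋₊|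
        ≤ (H : ℝ) ^ 2 * (x / L) := havg
      _ = (H : ℝ) * ((H : ℝ) * (x / L)) := by ring
      _ ≤ (H : ℝ) * x := mul_le_mul_of_nonneg_left h4 hHpos.le
  -- the prefactor `(N + H − 1)(B + H − 1) ≤ 6x`
  have hpre : (((⌊2 * A⌋₊ - ⌊A⌋₊ : ℕ) : ℝ) + H - 1) * ((⌊x / A⌋₊ : ℝ) + H - 1) ≤ 6 * x := by
    have h1 : ((⌊2 * A⌋₊ - ⌊A⌋₊ : ℕ) : ℝ) + H - 1 ≤ 3 * A := by linarith
    have h2 : (⌊x / A⌋₊ : ℝ) + H - 1 ≤ x / A + A := by linarith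
    have h2' : (0 : ℝ) ≤ (⌊x / A⌋₊ : ℝ) + H - 1 := by linarith
    calc (((⌊2 * A⌋₊ - ⌊A⌋₊ : ℕ) : ℝ) + H - 1) * ((⌊x / A⌋₊ : ℝ) + H - 1)
        ≤ (3 * A) * (x / A + A) := mul_le_mul h1 h2 h2' (by positivity)
      _ = 3 * x + 3 * A ^ 2 := by field_simp
      _ ≤ 6 * x := by linarith
  -- the bracket `N·B·H + 2·N·B·H + 4·ΣΣ|𝒞| ≤ 10·x·H`
  have hbr : ((⌊2 * A⌋₊ - ⌊A⌋₊ : ℕ) : ℝ) * (⌊x / A⌋₊ : ℝ) * H +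
      2 * ((⌊2 * A⌋₊ - ⌊A⌋₊ : ℕ) : ℝ) * (⌊x / A⌋₊ : ℝ) * H +
        4 * ∑ h ∈ Icc 1 (H - 1), ∑ k ∈ Icc 1 (H - 1),
          |cornerSum lam c h k ⌊A⌋₊ ⌊2 * A⌋₊ ⌊x / A⌋₊| ≤ 10 * x * H := by
    have h1 : ((⌊2 * A⌋₊ - ⌊A⌋₊ : ℕ) : ℝ) * (⌊x / A⌋₊ : ℝ) * H ≤ 2 * x * H :=
      mul_le_mul_of_nonneg_right hNB hHpos.le
    calc ((⌊2 * A⌋₊ - ⌊A⌋₊ : ℕ) : ℝ) * (⌊x / A⌋₊ : ℝ) * H +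
        2 * ((⌊2 * A⌋₊ - ⌊A⌋₊ : ℕ) : ℝ) * (⌊x / A⌋₊ : ℝ) * H +
          4 * ∑ h ∈ Icc 1 (H - 1), ∑ k ∈ Icc 1 (H - 1), |cornerSum lam c h k ⌊A⌋₊ ⌊2 * A⌋₊ ⌊x / A⌋₊|
        = 3 * (((⌊2 * A⌋₊ - ⌊A⌋₊ : ℕ) : ℝ) * (⌊x / A⌋₊ : ℝ) * H) +
          4 * ∑ h ∈ Icc 1 (H - 1), ∑ k ∈ Icc 1 (H - 1),
            |cornerSum lam c h k ⌊A⌋₊ ⌊2 * A⌋₊ ⌊x / A⌋₊| := by ring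
      _ ≤ 3 * (2 * x * H) + 4 * ((H : ℝ) * x) :=
          add_le_add (mul_le_mul_of_nonneg_left h1 (by norm_num))
            (mul_le_mul_of_nonneg_left hsum (by norm_num))
      _ = 10 * x * H := by ring
  have hbr0 : 0 ≤ ((⌊2 * A⌋₊ - ⌊A⌋₊ : ℕ) : ℝ) * (⌊x / A⌋₊ : ℝ) * H +
      2 * ((⌊2 * A⌋₊ - ⌊A⌋₊ : ℕ) : ℝ) * (⌊x / A⌋₊ : ℝ) * H +
        4 * ∑ h ∈ Icc 1 (H - 1), ∑ k ∈ Icc 1 (H - 1),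
          |cornerSum lam c h k ⌊A⌋₊ ⌊2 * A⌋₊ ⌊x / A⌋₊| := by
    have hs : 0 ≤ ∑ h ∈ Icc 1 (H - 1), ∑ k ∈ Icc 1 (H - 1),
        |cornerSum lam c h k ⌊A⌋₊ ⌊2 * A⌋₊ ⌊x / A⌋₊| :=
      sum_nonneg fun _ _ => sum_nonneg fun _ _ => abs_nonneg _
    have hp : 0 ≤ ((⌊2 * A⌋₊ - ⌊A⌋₊ : ℕ) : ℝ) * (⌊x / A⌋₊ : ℝ) * H := by positivity
    linarith
  -- `H² T ≤ 60 x² H`, cancel one `H`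
  have hmain : (H : ℝ) * H * momentN lam c ⌊A⌋₊ ⌊2 * A⌋₊ ⌊x / A⌋₊ ≤ (6 * x) * (10 * x * H) := by
    refine hv.trans ?_
    exact mul_le_mul hpre hbr hbr0 (by positivity)
  have hT0 : 0 ≤ momentN lam c ⌊A⌋₊ ⌊2 * A⌋₊ ⌊x / A⌋₊ := momentN_nonneg _ _ _ _ _
  have hHT : (H : ℝ) * momentN lam c ⌊A⌋₊ ⌊2 * A⌋₊ ⌊x / A⌋₊ ≤ 60 * x ^ 2 := by
    have h : (H : ℝ) * ((H : ℝ) * momentN lam c ⌊A⌋₊ ⌊2 * A⌋₊ ⌊x / A⌋₊) ≤ (H : ℝ) * (60 * x ^ 2) := by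
      calc (H : ℝ) * ((H : ℝ) * momentN lam c ⌊A⌋₊ ⌊2 * A⌋₊ ⌊x / A⌋₊)
          = (H : ℝ) * H * momentN lam c ⌊A⌋₊ ⌊2 * A⌋₊ ⌊x / A⌋₊ := by ring
        _ ≤ (6 * x) * (10 * x * H) := hmain
        _ = (H : ℝ) * (60 * x ^ 2) := by ring
    exact le_of_mul_le_mul_left h hHpos
  -- `L T ≤ 120 x²`
  have hLT : L * momentN lam c ⌊A⌋₊ ⌊2 * A⌋₊ ⌊x / A⌋₊ ≤ 120 * x ^ 2 := by
    calc L * momentN lam c ⌊A⌋₊ ⌊2 * A⌋₊ ⌊x / A⌋₊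
        ≤ (2 * H) * momentN lam c ⌊A⌋₊ ⌊2 * A⌋₊ ⌊x / A⌋₊ :=
          mul_le_mul_of_nonneg_right (by linarith) hT0
      _ = 2 * ((H : ℝ) * momentN lam c ⌊A⌋₊ ⌊2 * A⌋₊ ⌊x / A⌋₊) := by ring
      _ ≤ 2 * (60 * x ^ 2) := by linarith
      _ = 120 * x ^ 2 := by ring
  -- `L = (log x)^C · log x` and `log x ≥ 120`
  have hsplit : L = Real.log x ^ C * Real.log x := by
    rw [hL, Real.rpow_add hlogpos, Real.rpow_one]
  have hLCpos : 0 < Real.log x ^ C := Real.rpow_pos_of_pos hlogpos C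
  rw [hsplit] at hLT
  have h120 : Real.log x ^ C * 120 * momentN lam c ⌊A⌋₊ ⌊2 * A⌋₊ ⌊x / A⌋₊ ≤
      Real.log x ^ C * Real.log x * momentN lam c ⌊A⌋₊ ⌊2 * A⌋₊ ⌊x / A⌋₊ := by
    have h : Real.log x ^ C * 120 ≤ Real.log x ^ C * Real.log x :=
      mul_le_mul_of_nonneg_left (by linarith) hLCpos.le
    exact mul_le_mul_of_nonneg_right h hT0
  have hfin : Real.log x ^ C * momentN lam c ⌊A⌋₊ ⌊2 * A⌋₊ ⌊x / A⌋₊ ≤ x ^ 2 := by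
    have h := h120.trans hLT
    have h' : 120 * (Real.log x ^ C * momentN lam c ⌊A⌋₊ ⌊2 * A⌋₊ ⌊x / A⌋₊) ≤ 120 * x ^ 2 := by
      calc 120 * (Real.log x ^ C * momentN lam c ⌊A⌋₊ ⌊2 * A⌋₊ ⌊x / A⌋₊)
          = Real.log x ^ C * 120 * momentN lam c ⌊A⌋₊ ⌊2 * A⌋₊ ⌊x / A⌋₊ := by ring
        _ ≤ 120 * x ^ 2 := h
    linarith
  rw [le_div_iff₀ hLCpos]
  calc momentN lam c ⌊A⌋₊ ⌊2 * A⌋₊ ⌊x / A⌋₊ * Real.log x ^ C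
      = Real.log x ^ C * momentN lam c ⌊A⌋₊ ⌊2 * A⌋₊ ⌊x / A⌋₊ := by ring
    _ ≤ x ^ 2 := hfin

/-- Pointwise ⇒ averaged: `CornerChowla → AvgCornerChowla` (`(H−1)²` lags, each `≤ x/(log x)^K`). -/
theorem avgCornerChowla_of_cornerChowla (hC : CornerChowla) : AvgCornerChowla := by
  intro c hc δ hδ hδ' K hK
  obtain ⟨x₀, hx₀⟩ := hC c hc δ hδ hδ' K hK
  refine ⟨max x₀ 1, fun x hx A hA hA' => ?_⟩
  have hx₀x : x₀ ≤ x := le_trans (le_max_left _ _) hx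
  have hx1 : (1 : ℝ) ≤ x := le_trans (le_max_right _ _) hx
  set L : ℝ := Real.log x ^ K with hL
  have hL0 : 0 ≤ L := Real.rpow_nonneg (Real.log_nonneg hx1) K
  set H : ℕ := ⌊L⌋₊ with hHdef
  have hHleL : (H : ℝ) ≤ L := Nat.floor_le hL0
  have hxL : 0 ≤ x / L := div_nonneg (by linarith) hL0
  have hterm : ∀ h ∈ Icc 1 (H - 1), ∀ k ∈ Icc 1 (H - 1),
      |cornerSum lam c h k ⌊A⌋₊ ⌊2 * A⌋₊ ⌊x / A⌋₊| ≤ x / L := by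
    intro h hh k hk
    rw [mem_Icc] at hh hk
    have hhH : (h : ℝ) ≤ H := by exact_mod_cast (show h ≤ H by omega)
    have hkH : (k : ℝ) ≤ H := by exact_mod_cast (show k ≤ H by omega)
    exact hx₀ x hx₀x A hA hA' h k hh.1 (hhH.trans hHleL) hk.1 (hkH.trans hHleL)
  have h1 : ((H - 1 : ℕ) : ℝ) ≤ H := by exact_mod_cast Nat.sub_le H 1
  calc ∑ h ∈ Icc 1 (H - 1), ∑ k ∈ Icc 1 (H - 1), |cornerSum lam c h k ⌊A⌋₊ ⌊2 * A⌋₊ ⌊x / A⌋₊|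
      ≤ ∑ h ∈ Icc 1 (H - 1), ∑ k ∈ Icc 1 (H - 1), x / L :=
        sum_le_sum fun h hh => sum_le_sum fun k hk => hterm h hh k hk
    _ = ((H - 1 : ℕ) : ℝ) * (((H - 1 : ℕ) : ℝ) * (x / L)) := by
        simp only [sum_const, Nat.card_Icc, nsmul_eq_mul, Nat.add_sub_cancel]
    _ ≤ (H : ℝ) * ((H : ℝ) * (x / L)) :=
        mul_le_mul h1 (mul_le_mul_of_nonneg_right h1 hxL) (by positivity) (Nat.cast_nonneg _)
    _ = (H : ℝ) ^ 2 * (x / L) := by ring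

/-- **`TableChowla` from the two registered stubs** — `stub_doubleVdC` and (pointwise) `stub_corner`, through
their name-keyed aliases; factors through the averaged corner bound. -/
theorem tableChowla_of_stubs (hV : Registered.stub_doubleVdC) (hC : Registered.stub_corner) :
    Summit.Parity.GeneralizedHardyLittlewood.Theses.LiouvilleShiftedTables.TableChowla :=
  tableChowla_of_avg hV (avgCornerChowla_of_cornerChowla hC)

/-- **The crux from the two registered stubs, CLOSED modulo the stubs' `sorry`s**: `TableChowla_of`
concludes `LiouvilleShiftedTables.TableChowla` by name, feeding `stub_doubleVdC` and `stub_corner`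
(through their name-keyed aliases) into the composition `tableChowla_of_stubs`. -/
theorem TableChowla_of :
    Summit.Parity.GeneralizedHardyLittlewood.Theses.LiouvilleShiftedTables.TableChowla :=
  tableChowla_of_stubs doubleVdC_holds cornerChowla_holds

/-! ## The determinant identity and the fixed-shift 2-point reading of STUB 2 (kernel-checked) -/

/-- **Every 2×2 block of the shifted multiplication table has determinant `h k c`.** -/
theorem block_det (a b c h k : ℤ) :
    (a * b + c) * ((a + h) * (b + k) + c) - ((a + h) * b + c) * (a * (b + k) + c) = h * k * c := by
  ring

/-- `λ` at an integer argument (`Int.toNat` convention of the crux). -/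
def lamZ (z : ℤ) : ℝ := lam (Int.toNat z)

/-- The DETERMINANT-PAIR SUM: `Σ_{a,b ∈ box} λ(Q)·λ(Q + hkc)`, `Q = ((a+h)b+c)(a(b+k)+c)`. -/
def detPairSum (c : ℤ) (h k A₁ A₂ B : ℕ) : ℝ :=
  ∑ a ∈ Ioc A₁ (A₂ - h), ∑ b ∈ Icc 1 (B - k),
    lamZ ((((a : ℤ) + h) * b + c) * ((a : ℤ) * ((b : ℤ) + k) + c)) *
      lamZ ((((a : ℤ) + h) * b + c) * ((a : ℤ) * ((b : ℤ) + k) + c) + h * k * c)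

/-- `λ(m)λ(n) = λ(mn)` at nonnegative integer arguments. -/
theorem lamZ_mul {m n : ℤ} (hm : 0 ≤ m) (hn : 0 ≤ n) : lamZ m * lamZ n = lamZ (m * n) := by
  unfold lamZ
  have e : Int.toNat (m * n) = Int.toNat m * Int.toNat n := by
    have h1 : ((Int.toNat (m * n) : ℕ) : ℤ) = ((Int.toNat m * Int.toNat n : ℕ) : ℤ) := by
      rw [Int.toNat_of_nonneg (mul_nonneg hm hn), Nat.cast_mul, Int.toNat_of_nonneg hm,
        Int.toNat_of_nonneg hn]
    exact_mod_cast h1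
  rw [e, lam_mul]

/-- **STUB 2 is binary Chowla at the fixed shift `hkc` along the determinant family**: once the box
lies to the right of `−c` (`−c ≤ A₁`, automatic in the window for large `x`), every corner summand
`λ(ab+c)λ((a+h)b+c)λ(a(b+k)+c)λ((a+h)(b+k)+c)` equals `λ(Q)λ(Q+hkc)` with
`Q = ((a+h)b+c)(a(b+k)+c)` — and at `c = 0` it is `λ(Q)² = 1`. -/
theorem cornerSum_eq_detPairSum (c : ℤ) (h k A₁ A₂ B : ℕ) (hc : -c ≤ (A₁ : ℤ)) :
    cornerSum lam c h k A₁ A₂ B = detPairSum c h k A₁ A₂ B := by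
  unfold cornerSum detPairSum
  refine sum_congr rfl fun a ha => sum_congr rfl fun b hb => ?_
  rw [mem_Ioc] at ha
  rw [mem_Icc] at hb
  have ha1 : (A₁ : ℤ) + 1 ≤ (a : ℤ) := by exact_mod_cast ha.1
  have hb1 : (1 : ℤ) ≤ (b : ℤ) := by exact_mod_cast hb.1
  have hh0 : (0 : ℤ) ≤ (h : ℤ) := by exact_mod_cast Nat.zero_le h
  have hk0 : (0 : ℤ) ≤ (k : ℤ) := by exact_mod_cast Nat.zero_le k
  have ha0 : (0 : ℤ) ≤ (a : ℤ) := by exact_mod_cast Nat.zero_le a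
  have hA0 : (0 : ℤ) ≤ (A₁ : ℤ) := by exact_mod_cast Nat.zero_le A₁
  -- the four entries of the block are ≥ 1 (hence their `Int.toNat` is faithful)
  have hab : (a : ℤ) ≤ (a : ℤ) * b := le_mul_of_one_le_right ha0 hb1
  have hahb : (a : ℤ) + h ≤ ((a : ℤ) + h) * b := le_mul_of_one_le_right (by linarith) hb1
  have habk : (a : ℤ) ≤ (a : ℤ) * ((b : ℤ) + k) := le_mul_of_one_le_right ha0 (by linarith)
  have hahbk : (a : ℤ) + h ≤ ((a : ℤ) + h) * ((b : ℤ) + k) :=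
    le_mul_of_one_le_right (by linarith) (by linarith)
  have h1 : 0 ≤ (a : ℤ) * b + c := by linarith
  have h2 : 0 ≤ ((a : ℤ) + h) * b + c := by linarith
  have h3 : 0 ≤ (a : ℤ) * ((b : ℤ) + k) + c := by linarith
  have h4 : 0 ≤ ((a : ℤ) + h) * ((b : ℤ) + k) + c := by linarith
  have hdet : ((a : ℤ) * b + c) * (((a : ℤ) + h) * ((b : ℤ) + k) + c) =
      (((a : ℤ) + h) * b + c) * ((a : ℤ) * ((b : ℤ) + k) + c) + h * k * c := by ring
  show lamZ ((a : ℤ) * b + c) * lamZ (((a : ℤ) + h) * b + c) * lamZ ((a : ℤ) * ((b : ℤ) + k) + c) *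
      lamZ (((a : ℤ) + h) * ((b : ℤ) + k) + c) = _
  calc lamZ ((a : ℤ) * b + c) * lamZ (((a : ℤ) + h) * b + c) * lamZ ((a : ℤ) * ((b : ℤ) + k) + c) *
        lamZ (((a : ℤ) + h) * ((b : ℤ) + k) + c)
      = (lamZ (((a : ℤ) + h) * b + c) * lamZ ((a : ℤ) * ((b : ℤ) + k) + c)) *
          (lamZ ((a : ℤ) * b + c) * lamZ (((a : ℤ) + h) * ((b : ℤ) + k) + c)) := by ring
    _ = lamZ ((((a : ℤ) + h) * b + c) * ((a : ℤ) * ((b : ℤ) + k) + c)) *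
          lamZ (((a : ℤ) * b + c) * (((a : ℤ) + h) * ((b : ℤ) + k) + c)) := by
        rw [lamZ_mul h2 h3, lamZ_mul h1 h4]
    _ = _ := by rw [hdet]

end Summit.Parity.GeneralizedHardyLittlewood.Cruxes.TableChowla.CornerLocalBox

end
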